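import Literature.Computability.AlgebraicComplexity.TableauEvalContentDPSupport
import HarnessLib

/-!
# Content-state column-major programme pruned by the SUPPORT of the table (engine variant `evalMK` and its proofs)

Lean checker of the tableau highest-weight-vector certificates of the cell `val-lit` (Dörfler–Ikenmeyer–Panova's toy
model `Ch_4^7`; honest framing of that cell: kernel replay of a published computer verification at a KNOWN separation;
no claim about VP ≠ VNP or P ≠ NP is made here or there).

`evalM tab cap Nw` (`TableauEvalContentDP.lean`) prunes a label as soon as its content leaves the BOX `≤ cap`. At a
point with several monomials (base letters times one or two general forms) the box of the support is much larger than
its DOWN-SET: e.g. for the support `{(3,2,2,2), (2,3,2,2), (2,2,3,2), (2,2,2,3)}` the box is `≤ (3,3,3,3)` and admits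
contents like `(3,3,1,0)` that can never be completed to a nonzero table entry. This file runs the same programme with
the sharper test "the content is dominated by SOME key of nonzero value" (`domAny keys`, keys shipped with the
certificate and checked against the table): `bumpAllChkK`, `shiftOptK`, `stepMK`, `layersMK`, **`evalMK tab keys Nw`**,
the chunking identities, the proof **`evalMK_eq_evalC`** (same architecture as `evalM_eq_evalC`: the content recursion
`evalColsK`, the pruning lemma for down-sets, weighted-sum invariance of the merges) and the certificate theorem
**`coordRingMultiplicity_chowSet_pos_of_tableCertificateK`**; plus the delta-keyed literal layers `decodeDeltaLayerM`
(keys written as successive differences, a few digits each, for the chunk boundaries of long rows).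
Elementary [folklore] bookkeeping around [DorflerIkenmeyerPanova2020, §5]; no statement about representations.

## References
* [DorflerIkenmeyerPanova2020] J. Dörfler, C. Ikenmeyer, G. Panova, *On geometric complexity theory: multiplicity
  obstructions are stronger than occurrence obstructions*, SIAM J. Appl. Algebra Geom. 4 (2020) = arXiv:1901.04576,
  §5 (eq. (5.6) and the dynamic programme over content vectors, arXiv p. 13), Prop. 5.1 (arXiv p. 12).
-/

namespace Literature.Computability.AlgebraicComplexity

namespace TableauEval

open MvPolynomial

/-! ## §1 The programme pruned by a down-set -/

/-- `c` is dominated by some key of the list. [folklore] -/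
def domAny (keys : List (List ℕ)) (c : List ℕ) : Bool := keys.any fun k => domLE c k

/-- `bumpAt` checked against the down-set of `keys`: `none` if the bumped label is no longer dominated by any key.
[folklore] -/
def bumpChkK (keys : List (List ℕ)) : List (List ℕ) → ℕ → ℕ → Option (List (List ℕ))
  | [], _, _ => some []
  | c :: cs, 0, v => if domAny keys (incAt c v) then some (incAt c v :: cs) else none
  | c :: cs, u + 1, v => match bumpChkK keys cs u v with
    | some cs' => some (c :: cs')
    | none => none

/-- `bumpAll` checked box by box against the down-set of `keys`. [folklore] -/
def bumpAllChkK (keys : List (List ℕ)) : List (List ℕ) → List ℕ → List ℕ → Option (List (List ℕ))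
  | st, u :: us, v :: vs => match bumpChkK keys st u v with
    | some st' => bumpAllChkK keys st' us vs
    | none => none
  | st, _, _ => some st

section Program

variable {R : Type*} [CommRing R] [DecidableEq R]

/-- The signed shifted copy of a layer along one column option, dead states (by the down-set test) dropped.
[folklore] -/
def shiftOptK (keys : List (List ℕ)) (us : List ℕ) (o : Bool × List ℕ × ℕ)
    (L : List (ℕ × List (List ℕ) × R)) : List (ℕ × List (List ℕ) × R) :=
  L.filterMap fun e =>
    match bumpAllChkK keys e.2.1 us o.2.1 with
    | some st' => some (e.1 + o.2.2, st', if o.1 then -e.2.2 else e.2.2)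
    | none => none

/-- One column of the down-set-pruned programme. [folklore] -/
def stepMK (V : ℕ) (keys : List (List ℕ)) (c : Column) (L : List (ℕ × List (List ℕ) × R)) :
    List (ℕ × List (List ℕ) × R) :=
  mergeAll 8 ((colOpts V c).map fun o => shiftOptK keys c.labels o L)

/-- All columns, left to right. [folklore] -/
def layersMK (V : ℕ) (keys : List (List ℕ)) :
    List Column → List (ℕ × List (List ℕ) × R) → List (ℕ × List (List ℕ) × R)
  | [], L => L
  | c :: cs, L => layersMK V keys cs (stepMK V keys c L)

/-- **Content-state column-major evaluation pruned by the down-set of `keys`** — equal to `evalC P Nw` for networks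
passing the structural check and tables passing `checkTable` at `P` whose nonzero keys are dominated by `keys`
(`evalMK_eq_evalC`). [folklore] -/
def evalMK (tab : List (List ℕ × R)) (keys : List (List ℕ)) (Nw : Network) : R :=
  finalM tab (layersMK Nw.varBound keys Nw.cols Nw.initLayerM)

/-- **Chunking** for the down-set-pruned programme: Dörfler–Ikenmeyer–Panova's column-by-column transfer matrix split
between two columns. [cite: DorflerIkenmeyerPanova2020, §5 (the dynamic programme over content vectors, arXiv p. 13)] -/
theorem layersMK_append (V : ℕ) (keys : List (List ℕ)) : ∀ (cs₁ cs₂ : List Column)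
    (L : List (ℕ × List (List ℕ) × R)),
    layersMK V keys (cs₁ ++ cs₂) L = layersMK V keys cs₂ (layersMK V keys cs₁ L)
  | [], _, _ => rfl
  | _ :: cs₁, cs₂, _ => layersMK_append V keys cs₁ cs₂ _

/-- **`evalMK` in chunks** (split after the first `k` columns).
[cite: DorflerIkenmeyerPanova2020, §5 (the dynamic programme over content vectors, arXiv p. 13)] -/
theorem evalMK_eq_finalM_split (tab : List (List ℕ × R)) (keys : List (List ℕ)) (Nw : Network) (k : ℕ) :
    evalMK tab keys Nw = finalM tab (layersMK Nw.varBound keys (Nw.cols.drop k)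
      (layersMK Nw.varBound keys (Nw.cols.take k) Nw.initLayerM)) := by
  rw [← layersMK_append, List.take_append_drop]; rfl

end Program

/-! ## §2 Delta-keyed literal layers -/

/-- Prefix sums of the first components: `[(d₁, v₁), (d₂, v₂), …] ↦ [(d₁, v₁), (d₁ + d₂, v₂), …]`. [folklore] -/
def undeltaKeys {R : Type*} : ℕ → List (ℕ × R) → List (ℕ × R)
  | _, [] => []
  | acc, (δ, v) :: l => (acc + δ, v) :: undeltaKeys (acc + δ) l

/-- **Delta-keyed literal layer** for `layersM` / `layersMK`: keys written as successive differences (ascending order),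
then decoded by `decodeLayerM`. [folklore] -/
def decodeDeltaLayerM {R : Type*} (V n : ℕ) (L : List (ℕ × R)) : List (ℕ × List (List ℕ) × R) :=
  decodeLayerM V n (undeltaKeys 0 L)

/-! ## §3 Proofs -/

section Spec

variable {R : Type*} [CommRing R]

omit [CommRing R] in
/-- `incAt` keeps the length. [folklore] -/
private theorem length_incAt : ∀ (l : List ℕ) (i : ℕ), (incAt l i).length = l.length
  | [], _ => rfl
  | _ :: _, 0 => rfl
  | _ :: l, i + 1 => by simp [incAt, length_incAt l i]

omit [CommRing R] in
/-- Entries of `incAt`: entry `i` goes up by one, the others stay. [folklore] -/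
private theorem getD_incAt : ∀ (l : List ℕ) (i k : ℕ),
    (incAt l i).getD k 0 = l.getD k 0 + if k = i ∧ i < l.length then 1 else 0
  | [], i, k => by simp [incAt]
  | a :: l, 0, 0 => by simp [incAt]
  | a :: l, 0, k + 1 => by simp [incAt]
  | a :: l, i + 1, 0 => by simp [incAt]
  | a :: l, i + 1, k + 1 => by
    simp only [incAt, List.getD_cons_succ, getD_incAt l i k, List.length_cons]
    by_cases h : k = i ∧ i < l.length
    · rw [if_pos h, if_pos ⟨by omega, by omega⟩]
    · rw [if_neg h, if_neg (fun h' => h ⟨by omega, by omega⟩)]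

omit [CommRing R] in
/-- `bumpAt` keeps the number of labels. [folklore] -/
private theorem length_bumpAt : ∀ (st : List (List ℕ)) (u v : ℕ), (bumpAt st u v).length = st.length
  | [], _, _ => rfl
  | _ :: _, 0, _ => rfl
  | _ :: st, u + 1, v => by simp [bumpAt, length_bumpAt st u v]

omit [CommRing R] in
/-- `bumpAt` on the labels: label `u` is bumped, the others stay. [folklore] -/
private theorem getD_bumpAt : ∀ (st : List (List ℕ)) (u v u' : ℕ),
    (bumpAt st u v).getD u' [] = if u' = u ∧ u < st.length then incAt (st.getD u' []) v else st.getD u' []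
  | [], u, v, u' => by simp [bumpAt]
  | c :: st, 0, v, 0 => by simp [bumpAt]
  | c :: st, 0, v, u' + 1 => by simp [bumpAt]
  | c :: st, u + 1, v, 0 => by simp [bumpAt]
  | c :: st, u + 1, v, u' + 1 => by
    simp only [bumpAt, List.getD_cons_succ, getD_bumpAt st u v u', List.length_cons]
    by_cases h : u' = u ∧ u < st.length
    · rw [if_pos h, if_pos ⟨by omega, by omega⟩]
    · rw [if_neg h, if_neg (fun h' => h ⟨by omega, by omega⟩)]

omit [CommRing R] in
/-- `bumpAll` keeps the number of labels. [folklore] -/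
private theorem length_bumpAll : ∀ (st : List (List ℕ)) (us vs : List ℕ),
    (bumpAll st us vs).length = st.length
  | st, [], vs => by cases vs <;> rfl
  | st, _ :: _, [] => rfl
  | st, u :: us, v :: vs => by rw [bumpAll, length_bumpAll, length_bumpAt]

omit [CommRing R] in
/-- A count vector with an entry above its bound is not dominated. [folklore] -/
private theorem domLE_eq_false_of_lt : ∀ (c cap : List ℕ) (k : ℕ), k < c.length → cap.getD k 0 < c.getD k 0 →
    domLE c cap = false
  | [], _, _, h, _ => absurd h (Nat.not_lt_zero _)
  | a :: l, [], _, _, _ => rfl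
  | a :: l, b :: m, 0, _, h => by
    have h' : b < a := h
    simp [domLE, Nat.ble_eq, Nat.not_le.mpr h']
  | a :: l, b :: m, k + 1, hk, h => by
    simp only [List.getD_cons_succ, List.length_cons] at h hk
    simp [domLE, domLE_eq_false_of_lt l m k (by omega) h]

omit [CommRing R] in
/-- Domination is lost for good: a pointwise larger vector of the same length is not dominated either.
[folklore] -/
private theorem domLE_eq_false_mono : ∀ (c c' cap : List ℕ), c'.length = c.length →
    (∀ k, c.getD k 0 ≤ c'.getD k 0) → domLE c cap = false → domLE c' cap = false
  | [], c', cap, _, _, h => by simp [domLE] at h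
  | a :: l, [], cap, hl, _, _ => by simp at hl
  | a :: l, a' :: l', [], _, _, _ => rfl
  | a :: l, a' :: l', b :: m, hl, hle, h => by
    simp only [domLE, Bool.and_eq_false_iff] at h ⊢
    rcases h with h | h
    · left
      have h0 : a ≤ a' := hle 0
      have h' : ¬ a ≤ b := fun hab => by
        have : Nat.ble a b = true := Nat.ble_eq.mpr hab
        rw [this] at h; exact Bool.noConfusion h
      apply Bool.eq_false_iff.mpr
      intro h2
      have := Nat.ble_eq.mp h2
      omega
    · right
      exact domLE_eq_false_mono l l' m (by simpa using hl)
        (fun k => by simpa using hle (k + 1)) h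

omit [CommRing R] in
/-- `incAt` is pointwise increasing. [folklore] -/
private theorem getD_le_getD_incAt (l : List ℕ) (i k : ℕ) : l.getD k 0 ≤ (incAt l i).getD k 0 := by
  rw [getD_incAt]; omega

omit [CommRing R] in
/-- `bumpAll` is pointwise increasing on every label and keeps the lengths of the count vectors.
[folklore] -/
private theorem getD_bumpAll_dominates : ∀ (st : List (List ℕ)) (us vs : List ℕ) (u : ℕ),
    ((bumpAll st us vs).getD u []).length = (st.getD u []).length ∧
      ∀ k, (st.getD u []).getD k 0 ≤ ((bumpAll st us vs).getD u []).getD k 0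
  | st, [], vs, u => by cases vs <;> exact ⟨rfl, fun _ => le_rfl⟩
  | st, _ :: _, [], u => ⟨rfl, fun _ => le_rfl⟩
  | st, u' :: us, v :: vs, u => by
    rw [bumpAll]
    obtain ⟨h1, h2⟩ := getD_bumpAll_dominates (bumpAt st u' v) us vs u
    have h3 : ((bumpAt st u' v).getD u []).length = (st.getD u []).length ∧
        ∀ k, (st.getD u []).getD k 0 ≤ ((bumpAt st u' v).getD u []).getD k 0 := by
      rw [getD_bumpAt]
      split_ifs
      · exact ⟨length_incAt _ _, fun k => getD_le_getD_incAt _ _ _⟩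
      · exact ⟨rfl, fun _ => le_rfl⟩
    exact ⟨h1.trans h3.1, fun k => (h3.2 k).trans (h2 k)⟩


omit [CommRing R] in
/-- No key dominates a pointwise larger vector if none dominates the smaller one. [folklore] -/
private theorem domAny_eq_false_mono (keys : List (List ℕ)) (c c' : List ℕ) (hl : c'.length = c.length)
    (hle : ∀ k, c.getD k 0 ≤ c'.getD k 0) (h : domAny keys c = false) : domAny keys c' = false := by
  simp only [domAny, List.any_eq_false] at h ⊢
  intro k hk hdk
  have := domLE_eq_false_mono c c' k hl hle (by simpa using h k hk)
  rw [this] at hdk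
  exact Bool.false_ne_true hdk

/-- **Pruning by the down-set is sound**: if every content with a nonzero value is dominated by some key, a state with
a label dominated by no key evaluates to `0` under every list of remaining columns. [folklore] -/
private theorem evalColsK_eq_zero_of_not_domAny (S : List ℕ → R) (keys : List (List ℕ))
    (hS0 : ∀ c, S c ≠ 0 → domAny keys c = true) :
    ∀ (cs : List Column) (st : List (List ℕ)) (u : ℕ), u < st.length →
      domAny keys (st.getD u []) = false → evalColsK S cs st = 0
  | [], st, u, hu, h => by
    rw [evalColsK]
    apply List.prod_eq_zero
    rw [List.mem_map]
    refine ⟨st.getD u [], ?_, ?_⟩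
    · rw [List.getD_eq_getElem _ _ hu]; exact List.getElem_mem hu
    · by_contra hne
      have := hS0 _ hne
      rw [h] at this
      exact Bool.false_ne_true this
  | c :: cs, st, u, hu, h => by
    rw [evalColsK]
    apply List.sum_eq_zero
    intro x hx
    rw [List.mem_map] at hx
    obtain ⟨q, _, rfl⟩ := hx
    obtain ⟨h1, h2⟩ := getD_bumpAll_dominates st c.labels q.2 u
    rw [evalColsK_eq_zero_of_not_domAny S keys hS0 cs _ u (by rw [length_bumpAll]; exact hu)
      (domAny_eq_false_mono keys _ _ h1 h2 h), mul_zero]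

omit [CommRing R] in
/-- The checked label bump: `some (bumpAt st u v)` or `none`, and `none` only when label `u` is dominated by no key.
[folklore] -/
private theorem bumpChkK_spec (keys : List (List ℕ)) : ∀ (st : List (List ℕ)) (u v : ℕ),
    bumpChkK keys st u v = some (bumpAt st u v) ∨
      (bumpChkK keys st u v = none ∧ u < st.length ∧ domAny keys ((bumpAt st u v).getD u []) = false)
  | [], u, v => Or.inl rfl
  | c :: st, 0, v => by
    simp only [bumpChkK, bumpAt]
    by_cases h : domAny keys (incAt c v) = true
    · left; rw [if_pos h]
    · right; rw [if_neg h]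
      exact ⟨rfl, by simp, by simpa using h⟩
  | c :: st, u + 1, v => by
    simp only [bumpChkK, bumpAt]
    rcases bumpChkK_spec keys st u v with h | ⟨h, hu, hb⟩
    · left; rw [h]
    · right; rw [h]; exact ⟨rfl, by simpa using hu, by simpa using hb⟩

omit [CommRing R] in
/-- **The checked bump**: `bumpAllChkK keys st us vs` is `some (bumpAll st us vs)`, or it is `none` and some label of
the unchecked result is dominated by no key. [folklore] -/
private theorem bumpAllChkK_spec (keys : List (List ℕ)) : ∀ (st : List (List ℕ)) (us vs : List ℕ),
    bumpAllChkK keys st us vs = some (bumpAll st us vs) ∨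
      (bumpAllChkK keys st us vs = none ∧
        ∃ u, u < (bumpAll st us vs).length ∧ domAny keys ((bumpAll st us vs).getD u []) = false)
  | st, [], vs => by cases vs <;> exact Or.inl rfl
  | st, _ :: _, [] => Or.inl rfl
  | st, u :: us, v :: vs => by
    rw [bumpAllChkK, bumpAll]
    rcases bumpChkK_spec keys st u v with h | ⟨h, hu, hb⟩
    · rw [h]; exact bumpAllChkK_spec keys _ us vs
    · rw [h]
      right
      refine ⟨rfl, u, ?_, ?_⟩
      · rw [length_bumpAll, length_bumpAt]; exact hu
      · obtain ⟨h1, h2⟩ := getD_bumpAll_dominates (bumpAt st u v) us vs u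
        exact domAny_eq_false_mono keys _ _ h1 h2 hb

end Spec

section Program2

variable {R : Type*} [CommRing R] [DecidableEq R]

omit [DecidableEq R] in
/-- `wsum` of a cons. [folklore] -/
private theorem wsum_cons (G : List (List ℕ) → R) (a : ℕ × List (List ℕ) × R) (L : List (ℕ × List (List ℕ) × R)) :
    wsum G (a :: L) = a.2.2 * G a.2.1 + wsum G L := by
  simp [wsum]

omit [DecidableEq R] in
/-- `wsum` of the empty layer. [folklore] -/
private theorem wsum_nil (G : List (List ℕ) → R) : wsum G ([] : List (ℕ × List (List ℕ) × R)) = 0 := by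
  simp [wsum]

/-- The merge step preserves weighted sums. [folklore] -/
private theorem wsum_mergeMAux (G : List (List ℕ) → R) (a : ℕ × List (List ℕ) × R)
    (rest : List (ℕ × List (List ℕ) × R) → List (ℕ × List (List ℕ) × R)) (W : R)
    (hrest : ∀ l, wsum G (rest l) = W + wsum G l) :
    ∀ l₂ : List (ℕ × List (List ℕ) × R), wsum G (mergeMAux a rest l₂) = a.2.2 * G a.2.1 + W + wsum G l₂
  | [] => by rw [mergeMAux, wsum_cons, hrest, wsum_nil]; ring
  | b :: l₂ => by
    rw [mergeMAux]
    split_ifs with h1 h2 h3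
    · rw [wsum_cons, wsum_mergeMAux G a rest W hrest l₂, wsum_cons]; ring
    · simp only [Bool.and_eq_true, beq_iff_eq, decide_eq_true_eq] at h2
      rw [hrest, wsum_cons, ← h2.2]
      have : a.2.2 * G a.2.1 + b.2.2 * G a.2.1 = 0 := by rw [← add_mul, h3, zero_mul]
      linear_combination (-1 : R) * this
    · simp only [Bool.and_eq_true, beq_iff_eq, decide_eq_true_eq] at h2
      rw [hrest, wsum_cons, wsum_cons, ← h2.2]; ring
    · rw [wsum_cons, hrest, wsum_cons]; ring

/-- **`mergeM` preserves weighted sums.** [folklore] -/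
private theorem wsum_mergeM (G : List (List ℕ) → R) :
    ∀ l₁ l₂ : List (ℕ × List (List ℕ) × R), wsum G (mergeM l₁ l₂) = wsum G l₁ + wsum G l₂
  | [], l₂ => by rw [mergeM, wsum_nil, zero_add]
  | a :: l₁, l₂ => by
    rw [mergeM, wsum_mergeMAux G a (mergeM l₁) (wsum G l₁) (wsum_mergeM G l₁) l₂, wsum_cons]

/-- `mergePairs` preserves the total weighted sum. [folklore] -/
private theorem wsum_mergePairs (G : List (List ℕ) → R) :
    ∀ Ls : List (List (ℕ × List (List ℕ) × R)),
      ((mergePairs Ls).map (wsum G)).sum = (Ls.map (wsum G)).sum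
  | [] => rfl
  | [_] => rfl
  | a :: b :: Ls => by
    rw [mergePairs, List.map_cons, List.sum_cons, wsum_mergeM, wsum_mergePairs G Ls]
    simp [add_assoc]

/-- The sequential merge preserves the total weighted sum. [folklore] -/
private theorem wsum_foldr_mergeM (G : List (List ℕ) → R) :
    ∀ Ls : List (List (ℕ × List (List ℕ) × R)), wsum G (Ls.foldr mergeM []) = (Ls.map (wsum G)).sum
  | [] => by simp [wsum]
  | L :: Ls => by rw [List.foldr_cons, wsum_mergeM, wsum_foldr_mergeM G Ls, List.map_cons, List.sum_cons]

/-- **`mergeAll` preserves the total weighted sum.** [folklore] -/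
private theorem wsum_mergeAll (G : List (List ℕ) → R) :
    ∀ (n : ℕ) (Ls : List (List (ℕ × List (List ℕ) × R))), wsum G (mergeAll n Ls) = (Ls.map (wsum G)).sum
  | 0, Ls => by rw [mergeAll]; exact wsum_foldr_mergeM G Ls
  | n + 1, [] => by rw [mergeAll]; simp [wsum]
  | n + 1, [L] => by rw [mergeAll]; simp
  | n + 1, L :: L' :: Ls => by rw [mergeAll, wsum_mergeAll G n, wsum_mergePairs]

omit [DecidableEq R] in
/-- A signed value times `X` is the value times the signed `X`. [folklore] -/
private theorem ite_neg_mul (b : Bool) (v X : R) : (if b then -v else v) * X = v * (sgn b * X) := by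
  cases b <;> simp [sgn]


omit [DecidableEq R] in
/-- **The shifted copy along one column option carries the signed bumped weighted sum** (dropped states evaluate to
zero). [folklore] -/
private theorem wsum_shiftOptK (S : List ℕ → R) (keys : List (List ℕ)) (hS0 : ∀ c, S c ≠ 0 → domAny keys c = true)
    (cs : List Column) (us : List ℕ) (o : Bool × List ℕ × ℕ) :
    ∀ L : List (ℕ × List (List ℕ) × R),
      wsum (evalColsK S cs) (shiftOptK keys us o L) =
        (L.map fun e => e.2.2 * (sgn o.1 * evalColsK S cs (bumpAll e.2.1 us o.2.1))).sum
  | [] => by simp [shiftOptK, wsum]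
  | e :: L => by
    have IH := wsum_shiftOptK S keys hS0 cs us o L
    simp only [shiftOptK, List.filterMap_cons] at IH ⊢
    rcases bumpAllChkK_spec keys e.2.1 us o.2.1 with h | ⟨h, u, hu, hdom⟩
    · rw [h, List.map_cons, List.sum_cons, ← IH, wsum, List.map_cons, List.sum_cons, ite_neg_mul]
      rfl
    · rw [h, List.map_cons, List.sum_cons, ← IH,
        evalColsK_eq_zero_of_not_domAny S keys hS0 cs _ u hu hdom, mul_zero, mul_zero, zero_add]

omit [DecidableEq R] in
/-- Swapping a double sum over two lists. [folklore] -/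
private theorem sum_map_comm {α β : Type*} (f : α → β → R) :
    ∀ (l₁ : List α) (l₂ : List β),
      (l₁.map fun a => (l₂.map fun b => f a b).sum).sum = (l₂.map fun b => (l₁.map fun a => f a b).sum).sum
  | [], l₂ => by simp
  | a :: l₁, l₂ => by
    rw [List.map_cons, List.sum_cons, sum_map_comm f l₁ l₂, ← List.sum_map_add]
    rfl

/-- **One column step preserves the meaning of a layer.** [folklore] -/
private theorem wsum_stepMK (S : List ℕ → R) (keys : List (List ℕ)) (hS0 : ∀ c, S c ≠ 0 → domAny keys c = true)
    (V : ℕ) (c : Column) (cs : List Column) (L : List (ℕ × List (List ℕ) × R)) :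
    wsum (evalColsK S cs) (stepMK V keys c L) = wsum (evalColsK S (c :: cs)) L := by
  rw [stepMK, wsum_mergeAll, List.map_map, colOpts, List.map_map]
  have h1 : ((permsSign c.vars).map ((wsum (evalColsK S cs) ∘ fun o => shiftOptK keys c.labels o L) ∘
      fun q => (q.1, q.2, keyDelta V c.labels q.2))) =
      (permsSign c.vars).map fun q =>
        (L.map fun e => e.2.2 * (sgn q.1 * evalColsK S cs (bumpAll e.2.1 c.labels q.2))).sum := by
    refine List.map_congr_left fun q _ => ?_
    simp only [Function.comp]
    exact wsum_shiftOptK S keys hS0 cs c.labels _ L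
  rw [h1, sum_map_comm]
  unfold wsum
  congr 1
  refine List.map_congr_left fun e _ => ?_
  rw [evalColsK, List.sum_map_mul_left]

/-- **All column steps preserve the meaning.** [folklore] -/
private theorem wsum_layersMK (S : List ℕ → R) (keys : List (List ℕ)) (hS0 : ∀ c, S c ≠ 0 → domAny keys c = true)
    (V : ℕ) : ∀ (cs : List Column) (L : List (ℕ × List (List ℕ) × R)),
      wsum (evalColsK S []) (layersMK V keys cs L) = wsum (evalColsK S cs) L
  | [], _ => rfl
  | c :: cs, L => by rw [layersMK, wsum_layersMK S keys hS0 V cs, wsum_stepMK S keys hS0]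

omit [DecidableEq R] in
/-- The final value of a layer is its weighted sum against no remaining column. [folklore] -/
private theorem finalM_eq_wsum (tab : List (List ℕ × R)) (L : List (ℕ × List (List ℕ) × R)) :
    finalM tab L = wsum (evalColsK (lookupC tab) []) L := by
  unfold finalM wsum
  rfl

omit [DecidableEq R] in
/-- Nonzero table values sit at keys of the table: if `lookupC tab c ≠ 0` then some entry `(c, value)`
of the table has that nonzero value. [folklore] -/
private theorem exists_mem_of_lookupC_ne_zero (tab : List (List ℕ × R)) (c : List ℕ) (h : lookupC tab c ≠ 0) :
    ∃ e ∈ tab, e.1 = c ∧ e.2 ≠ 0 := by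
  unfold lookupC at h
  cases hf : tab.find? (fun e => e.1 == c) with
  | none => rw [hf] at h; exact absurd rfl h
  | some e =>
    rw [hf] at h
    refine ⟨e, List.mem_of_find?_eq_some hf, ?_, h⟩
    have := List.find?_some hf
    exact beq_iff_eq.mp this

end Program2

/-! ## §4 `evalMK = evalC` and the certificate theorem -/

section Main

variable {R : Type*} [CommRing R] [DecidableEq R]

omit [DecidableEq R] in
/-- The empty words have zero content. [folklore] -/
private theorem map_counts_replicate_nil (V d : ℕ) :
    (List.replicate d ([] : List ℕ)).map (counts V) = List.replicate d (List.replicate V 0) := by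
  simp [counts, List.map_replicate]

/-- **The down-set-pruned content-state programme computes the column-major evaluator**: for a list point all of whose
terms have `m = Nw.perLabel` forms, a network passing its structural check, a content table passing `checkTable` at
`(V, m) = (Nw.varBound, Nw.perLabel)` and a key list dominating every key of the table with a nonzero value,
`evalMK tab keys Nw = evalC P Nw`. No column-strictness is required.
[cite: DorflerIkenmeyerPanova2020, §5 eq. (5.6) and the dynamic programme over content vectors (arXiv p. 13)] -/
theorem evalMK_eq_evalC (P : Point R) (Nw : Network) (tab : List (List ℕ × R)) (keys : List (List ℕ))
    (hP : ∀ t : Fin P.terms.length, (P.terms.get t).2.length = Nw.perLabel)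
    (hN : Nw.check = true)
    (htab : checkTable P Nw.varBound Nw.perLabel tab = true)
    (hkeys : ∀ e ∈ tab, e.2 ≠ 0 → domAny keys e.1 = true) :
    evalMK tab keys Nw = evalC P Nw := by
  obtain ⟨hlen, hlab, hcnt⟩ := Network.spec_of_check Nw hN
  have hV : 0 < Nw.varBound := Nat.succ_pos _
  have hS0 : ∀ c, lookupC tab c ≠ 0 → domAny keys c = true := by
    intro c hc
    obtain ⟨e, he, rfl, hne⟩ := exists_mem_of_lookupC_ne_zero tab c hc
    exact hkeys e he hne
  have hS : ∀ w : List ℕ, w.length = Nw.perLabel → (∀ v ∈ w, v < Nw.varBound) →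
      symEntry P w = lookupC tab (counts Nw.varBound w) := fun w hw hv =>
    (lookupC_counts_eq_symEntry P hV tab htab hP w hw hv).symm
  rw [evalMK, finalM_eq_wsum, wsum_layersMK _ keys hS0, Network.initLayerM, wsum_cons, wsum_nil, add_zero,
    one_mul, evalC, ← map_counts_replicate_nil]
  symm
  refine evalCols_eq_evalColsK P Nw.varBound Nw.perLabel Nw.nlabels (lookupC tab) hS Nw.cols _
    (List.length_replicate ..) (fun w hw => ?_) (fun u hu => ?_) hlen
    (fun c hc v hv => lt_varBound Nw c hc v hv)
  · rw [List.eq_of_mem_replicate hw]; simp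
  · rw [List.getD_eq_getElem _ _ (by simpa using hu), List.getElem_replicate]
    simpa [Network.allLabels] using hcnt u hu

end Main

section Certificate

variable {N : ℕ} [NeZero N]

/-- `chowPoint` commutes with ring maps. [folklore] -/
private theorem chowPoint_map' {R S : Type*} [CommRing R] [CommRing S] (f : R →+* S) (rows : List (List R)) :
    (chowPoint rows).map f = chowPoint (rows.map fun ℓ => ℓ.map f) := by
  simp [chowPoint, Point.map]

/-- **One-entry certificate, down-set-pruned content-state programme** (DIP Prop. 5.1's "`mult_μ(ℂ[Ch]) > 0`"): one
network of shape `λ` with canonical alternators passing its structural check, one integer Chow point of `Ch_N^m` with its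
checked content table, a key list dominating the table's nonzero keys, and a NONZERO value of `evalMK` give
`0 < mult_{λ^*} K[Ch_N^m]`. [cite: DorflerIkenmeyerPanova2020, Prop. 5.1 and §5 (arXiv pp. 12–13)] -/
theorem coordRingMultiplicity_chowSet_pos_of_tableCertificateK (K : Type) [Field K] [CharZero K]
    {m e : ℕ} (hm : m ≠ 0) (lam : Nat.Partition e) (lamL : List ℕ)
    (hlamL : lam.sortedParts = lamL) (hlen : lamL.length ≤ N)
    (Nw : Network) (rows : List (List ℤ)) (tab : List (List ℕ × ℤ)) (keys : List (List ℕ))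
    (hnet : Nw.check = true ∧ Nw.canonicalVars = true ∧ Nw.perLabel = m ∧ Nw.shape = lamL)
    (hrows : rows.length = m) (htab : checkTable (chowPoint rows) Nw.varBound m tab = true)
    (hkeys : (tab.all fun en => decide (en.2 = 0) || domAny keys en.1) = true)
    (v : ℤ) (hval : evalMK tab keys Nw = v) (hv : v ≠ 0) :
    0 < coordRingMultiplicity K (chowSet K N m) m
      (_root_.Literature.NumberTheory.DiophantineGeometry.Weight.dualOfPartition N lam) := by
  obtain ⟨hchk, hcan, hpl, hsh⟩ := hnet
  classical
  let nets : Fin 1 → Network := fun _ => Nw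
  let pts : Fin 1 → Point ℤ := fun _ => chowPoint rows
  have hpts : ∀ b, ∀ t ∈ (pts b).terms, t.2.length = m := by
    intro b t ht
    simp only [pts, chowPoint, List.mem_singleton] at ht
    subst ht; exact hrows
  have hZ : ∀ b, splfPoly (coefM ((pts b).map (Int.castRingHom K)))
      (formM (finRevEnum N) ((pts b).map (Int.castRingHom K)) m) ∈ chowSet K N m := by
    intro b
    rw [show (pts b).map (Int.castRingHom K) =
        chowPoint (rows.map fun ℓ => ℓ.map (Int.castRingHom K)) from chowPoint_map' _ _]
    exact splfPoly_oneTerm_mem_chowSet (N := N) K m _ _ rfl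
  have hkeys' : ∀ en ∈ tab, en.2 ≠ 0 → domAny keys en.1 = true := by
    intro en hen hne
    have := (List.all_eq_true.mp hkeys) en hen
    simp only [Bool.or_eq_true, decide_eq_true_eq] at this
    exact this.resolve_left hne
  have hev : evalC (chowPoint rows) Nw = v := by
    rw [← hval]
    refine (evalMK_eq_evalC (chowPoint rows) Nw tab keys (fun t => ?_) hchk (hpl.symm ▸ htab) hkeys').symm
    have : ((chowPoint rows).terms.get t) = (1, rows) := by
      have ht := t.isLt
      simp only [chowPoint, List.length_singleton, Nat.lt_one_iff] at ht
      simp [chowPoint, List.get_eq_getElem]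
    rw [this, hpl]; exact hrows
  have hdet : (Matrix.of fun a b => evalC (pts b) (nets a)).det ≠ 0 := by
    rw [Matrix.det_fin_one, Matrix.of_apply]
    show evalC (chowPoint rows) Nw ≠ 0
    rw [hev]; exact hv
  exact le_coordRingMultiplicity_of_certificate K hm lam lamL hlamL hlen nets
    (fun _ => hchk) (fun _ => hcan) (d := Nw.nlabels) (fun _ => rfl) (fun _ => hpl) (fun _ => hsh)
    pts hpts _ hZ hdet

end Certificate

/-! ## §5 Sanity values (kernel) -/

/-- On the landed reciprocal certificate `DIP20Prop51Reciprocal47Q02.lean` (row `(10, 10, 7, 1)`): the down-set-pruned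
programme with the table's nonzero keys gives the same value `75497472` as `evalTS`; and a delta-keyed literal decodes to
absolute keys. [folklore] -/
example :
    let N : Network := ⟨7, 4, [⟨[0, 1, 2, 3], [3, 4, 5, 6]⟩, ⟨[0, 1, 2], [0, 2, 3]⟩,
      ⟨[0, 1, 2], [0, 2, 3]⟩, ⟨[0, 1, 2], [0, 2, 3]⟩, ⟨[0, 1, 2], [0, 4, 5]⟩, ⟨[0, 1, 2], [1, 5, 6]⟩,
      ⟨[0, 1, 2], [1, 5, 6]⟩, ⟨[0, 1], [1, 2]⟩, ⟨[0, 1], [1, 4]⟩, ⟨[0, 1], [4, 6]⟩]⟩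
    let tab : List (List ℕ × ℤ) :=
      [([1, 1, 1, 1], 2), ([1, 2, 1, 0], -8), ([2, 0, 1, 1], -2), ([3, 0, 1, 0], 6)]
    evalMK tab [[1, 1, 1, 1], [1, 2, 1, 0], [2, 0, 1, 1], [3, 0, 1, 0]] N = 75497472 ∧
      undeltaKeys 0 [(5, (1 : ℤ)), (3, 2), (10, -1)] = [(5, 1), (8, 2), (18, -1)] := by
  decide +kernel

/-! ## §6 Splitting a layer (linearity of the programme in the layer)

Dörfler–Ikenmeyer–Panova's transfer-matrix programme is LINEAR in the current layer: the value obtained from a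
concatenation of layers is the sum of the values, and a re-merged family of partial layers has the value of the sum of
the family. These identities let a kernel certificate cut one heavy column into slices of its input layer (each slice
its own `decide`), re-merge the partial outputs, and continue — every chunk boundary a literal, every piece small. -/

section Split

variable {R : Type*} [CommRing R] [DecidableEq R]

omit [DecidableEq R] in
/-- `wsum` of a concatenation. [folklore] -/
private theorem wsum_append (G : List (List ℕ) → R) (L₁ L₂ : List (ℕ × List (List ℕ) × R)) :
    wsum G (L₁ ++ L₂) = wsum G L₁ + wsum G L₂ := by
  unfold wsum
  rw [List.map_append, List.sum_append]

/-- From the boolean key check of a certificate to the support hypothesis of the programme. [folklore] -/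
private theorem lookupC_support_of_all (tab : List (List ℕ × R)) (keys : List (List ℕ))
    (hkeys : (tab.all fun en => decide (en.2 = 0) || domAny keys en.1) = true) :
    ∀ c, lookupC tab c ≠ 0 → domAny keys c = true := by
  intro c hc
  obtain ⟨e, he, rfl, hne⟩ := exists_mem_of_lookupC_ne_zero tab c hc
  have := (List.all_eq_true.mp hkeys) e he
  simp only [Bool.or_eq_true, decide_eq_true_eq] at this
  exact this.resolve_left hne

/-- **The programme is additive in the layer**: running the remaining columns from `L₁ ++ L₂` gives the sum of the two
runs (Dörfler–Ikenmeyer–Panova's column transfer matrices are linear maps; here for the down-set-pruned programme, under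
the certificate's key check). [cite: DorflerIkenmeyerPanova2020, §5 (the dynamic programme over content vectors = a
product of transfer matrices, arXiv p. 13)] -/
theorem finalM_layersMK_append (tab : List (List ℕ × R)) (keys : List (List ℕ))
    (hkeys : (tab.all fun en => decide (en.2 = 0) || domAny keys en.1) = true)
    (V : ℕ) (cs : List Column) (L₁ L₂ : List (ℕ × List (List ℕ) × R)) :
    finalM tab (layersMK V keys cs (L₁ ++ L₂)) =
      finalM tab (layersMK V keys cs L₁) + finalM tab (layersMK V keys cs L₂) := by
  have hS0 := lookupC_support_of_all tab keys hkeys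
  rw [finalM_eq_wsum, finalM_eq_wsum, finalM_eq_wsum, wsum_layersMK _ keys hS0, wsum_layersMK _ keys hS0,
    wsum_layersMK _ keys hS0, wsum_append]

/-- **Re-merging partial layers**: running the remaining columns from the merge `mergeAll n Ls` of a family of partial
layers gives the sum of the runs from its members (the merge only adds coefficients of equal states and drops zeros).
[cite: DorflerIkenmeyerPanova2020, §5 (the dynamic programme over content vectors = a product of transfer matrices,
arXiv p. 13)] -/
theorem finalM_layersMK_mergeAll (tab : List (List ℕ × R)) (keys : List (List ℕ))
    (hkeys : (tab.all fun en => decide (en.2 = 0) || domAny keys en.1) = true)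
    (V : ℕ) (cs : List Column) (n : ℕ) (Ls : List (List (ℕ × List (List ℕ) × R))) :
    finalM tab (layersMK V keys cs (mergeAll n Ls)) =
      (Ls.map fun L => finalM tab (layersMK V keys cs L)).sum := by
  have hS0 := lookupC_support_of_all tab keys hkeys
  rw [finalM_eq_wsum, wsum_layersMK _ keys hS0, wsum_mergeAll]
  congr 1
  refine List.map_congr_left fun L _ => ?_
  rw [finalM_eq_wsum, wsum_layersMK _ keys hS0]

/-- **One sliced column**: if the input layer is the concatenation `S₁ ++ S₂` of two slices whose one-column outputs
are `P₁`, `P₂`, and the merged family `mergeAll n [P₁, P₂]` is the next layer `L'`, then the value from `S₁ ++ S₂`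
through `c :: cs` is the value from `L'` through `cs`. [cite: DorflerIkenmeyerPanova2020, §5 (the dynamic programme
over content vectors = a product of transfer matrices, arXiv p. 13)] -/
theorem finalM_layersMK_cons_of_slices₂ (tab : List (List ℕ × R)) (keys : List (List ℕ))
    (hkeys : (tab.all fun en => decide (en.2 = 0) || domAny keys en.1) = true)
    (V : ℕ) (c : Column) (cs : List Column) (n : ℕ) (S₁ S₂ P₁ P₂ L' : List (ℕ × List (List ℕ) × R))
    (h₁ : stepMK V keys c S₁ = P₁) (h₂ : stepMK V keys c S₂ = P₂) (hm : mergeAll n [P₁, P₂] = L') :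
    finalM tab (layersMK V keys (c :: cs) (S₁ ++ S₂)) = finalM tab (layersMK V keys cs L') := by
  rw [finalM_layersMK_append tab keys hkeys, layersMK, layersMK, h₁, h₂, ← hm,
    finalM_layersMK_mergeAll tab keys hkeys]
  simp

/-- **One sliced column, three slices.** [cite: DorflerIkenmeyerPanova2020, §5 (the dynamic programme over content
vectors = a product of transfer matrices, arXiv p. 13)] -/
theorem finalM_layersMK_cons_of_slices₃ (tab : List (List ℕ × R)) (keys : List (List ℕ))
    (hkeys : (tab.all fun en => decide (en.2 = 0) || domAny keys en.1) = true)
    (V : ℕ) (c : Column) (cs : List Column) (n : ℕ) (S₁ S₂ S₃ P₁ P₂ P₃ L' : List (ℕ × List (List ℕ) × R))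
    (h₁ : stepMK V keys c S₁ = P₁) (h₂ : stepMK V keys c S₂ = P₂) (h₃ : stepMK V keys c S₃ = P₃)
    (hm : mergeAll n [P₁, P₂, P₃] = L') :
    finalM tab (layersMK V keys (c :: cs) (S₁ ++ S₂ ++ S₃)) = finalM tab (layersMK V keys cs L') := by
  rw [finalM_layersMK_append tab keys hkeys, finalM_layersMK_append tab keys hkeys, layersMK, layersMK, layersMK,
    h₁, h₂, h₃, ← hm, finalM_layersMK_mergeAll tab keys hkeys]
  simp [add_assoc]

/-- **One sliced column, any number of slices**: slices `Ss`, their one-column outputs `Ps` (pointwise), merged to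
`L'`. [cite: DorflerIkenmeyerPanova2020, §5 (the dynamic programme over content vectors = a product of transfer
matrices, arXiv p. 13)] -/
theorem finalM_layersMK_cons_of_slices (tab : List (List ℕ × R)) (keys : List (List ℕ))
    (hkeys : (tab.all fun en => decide (en.2 = 0) || domAny keys en.1) = true)
    (V : ℕ) (c : Column) (cs : List Column) (n : ℕ)
    (Ss Ps : List (List (ℕ × List (List ℕ) × R))) (L' : List (ℕ × List (List ℕ) × R))
    (hlen : Ss.length = Ps.length) (hstep : ∀ i : Fin Ss.length, stepMK V keys c (Ss.get i) = Ps.get (i.cast hlen))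
    (hm : mergeAll n Ps = L') :
    finalM tab (layersMK V keys (c :: cs) Ss.flatten) = finalM tab (layersMK V keys cs L') := by
  have hS0 := lookupC_support_of_all tab keys hkeys
  subst hm
  rw [finalM_layersMK_mergeAll tab keys hkeys]
  induction Ss generalizing Ps with
  | nil =>
    cases Ps with
    | nil =>
      simp only [List.flatten_nil, List.map_nil, List.sum_nil]
      rw [finalM_eq_wsum, wsum_layersMK _ keys hS0, wsum_nil]
    | cons _ _ => simp at hlen
  | cons S Ss ih =>
    cases Ps with
    | nil => simp at hlen
    | cons P Ps =>
      rw [List.flatten_cons, finalM_layersMK_append tab keys hkeys, List.map_cons, List.sum_cons, layersMK,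
        show stepMK V keys c S = P from hstep ⟨0, by simp⟩]
      congr 1
      refine ih Ps (by simpa using hlen) fun i => ?_
      have := hstep ⟨i.1 + 1, by simp⟩
      simpa using this

end Split

end TableauEval

end Literature.Computability.AlgebraicComplexity
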